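import Summits.QuantumAdvantage.QuantumAdvantage.Theorems.SosSandwichCircuitToQuery
import Summits.QuantumAdvantage.QuantumAdvantage.Theorems.SosSandwichTransferPBPathBoundChainFinal
import Summits.QuantumAdvantage.QuantumAdvantage.Theorems.SosSandwichQueryRestrict
import Summits.QuantumAdvantage.QuantumAdvantage.Theorems.SosSandwichQueryLevelDescentLine
import Literature.Computability.Cryptography.QubitRegisterCliffordTProofs
import HarnessLib

/-!
# Route `SosSandwich`: the summit assembly with the analytic crux = the Aaronson–Ambainis conjecture for QUERY algorithms

Support theorem for route `SosSandwich` (crux `PseudoBoundedAA`, stmt-QuantumAdvantage-15237; route-level repair census).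
`Theorems/SosSandwichTransferPBPathBoundChainFinal.lean` re-threaded the closed crux `TransferPB` so that the summit needs the
Aaronson–Ambainis influence bound only in the form `AApath` — for RESTRICTIONS `p_x|_ρ` of acceptance polynomials of
Clifford+T oracle circuits (`transfer_of_pathBound`, `quantumAdvantage_of_pathBound`) — and listed as item (1) of the
remaining-lemma census the modeling bridge "oracle circuit ⟹ quantum query algorithm".  With that bridge
(`Theorems/SosSandwichCircuitToQuery.lean`: `exists_queryAlg_acceptPoly`) and the restriction-closure of the class `Q_T` of
quantum query acceptance probabilities (`Theorems/SosSandwichQueryRestrict.lean`: `restrictAlg_acceptProb`) this file proves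

* `exists_alg_restrictPath` — every restriction `p|_ρ` of a `T`-query acceptance polynomial is a `T`-query acceptance
  polynomial;
* **`pathBound_of_aaQuery`** — `AA_Q ⟹ AApath` for every unitary gate set (`AA_Q` = the Aaronson–Ambainis conjecture for
  the acceptance probabilities of quantum query algorithms, inline as in `QueryRestrict.quantumQuerySimulable_of_aaQuery`:
  `∃ c C > 0, ∀ N Q p ε, 1 ≤ T(Q) → p ≡ acceptProb Q on the cube → 0 < ε ≤ Var[p] → ∃ i, C (ε/T)^c ≤ Inf_i[p]`; the
  degree bound `thm23Degree = 2·#oracle gates + 1 ≥ #queries` only weakens the conclusion; `0` relevant bits or `0` oracle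
  gates give variance `0`);
* **`transfer_of_aaQuery`** (`AA_Q → PromiseBQP ⊆ PromiseBPP' → ∀ᵐ A, BQP^A ⊆ AvgP^A`) and **`quantumAdvantage_of_aaQuery`**
  (`AA_Q → RandomOracleHeurSeparation → PromiseLanguageLift → QuantumAdvantage`): the summit assembly of the route runs with
  its analytic crux weakened from PB-AA (the SOS class `K_T`) all the way down to the textbook class `Q_T`;
* `quantumAdvantage_of_levelDescentQ` — composed with the `Q_T` line (`QueryTopLevel.aaQuery_of_levelDescentQ`, whose two base
  rungs are PROVED): the route's one open analytic piece is LevelDescent inside `Q_T`.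
The registered crux and the full conjecture enter through `aaQuery_of_pseudoBoundedAA` / `aaQuery_of_aaConjecture`
(`Theorems/SosSandwichPseudoBoundedAAQuerySimulable.lean`), so this chain refines the route's `closes`.

Lattice (all in tree): `AAConjecture ⟹ PseudoBoundedAA ⟹ AA_Q ⟸ LevelDescent_Q`, and now `AA_Q ⟹ AApath ⟹ (X_ROG → PL →
QuantumAdvantage)`.  Honest label: modeling + re-threading; `AA_Q` is Aaronson–Ambainis' open conjecture restricted to quantum
acceptance probabilities — no stub, crux or summit is proved here.  No named fact; axioms standard.
Sources: AaronsonAmbainis2014 Thm. 7 (iii), Thm. 23 (proof, p. 14), Conj. 6; BealsEtAl2001 §2; BuhrmanDewolf2002 §3.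
-/

noncomputable section
-- D-0017: single-conjunct summit ⇒ the duplicate `QuantumAdvantage.QuantumAdvantage` is mandated.
set_option linter.dupNamespace false

namespace Summit.QuantumAdvantage.QuantumAdvantage.Theorems.SosSandwich.QueryCrux

open MeasureTheory Literature.Computability.Cryptography Literature.Computability.Complexity
  Literature.Computability.QuantumComplexity
open Summit.QuantumAdvantage.QuantumAdvantage.Theses.SosSandwich
open Summit.QuantumAdvantage.QuantumAdvantage.Cruxes.TransferPB.Birth
open Summit.QuantumAdvantage.QuantumAdvantage.Cruxes.TransferPB.Birth.SimTreePB (restrictPath restrictPath_cons)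
open Summit.QuantumAdvantage.QuantumAdvantage.Theorems.SosSandwich.QueryRestrict (restrictAlg restrictAlg_acceptProb)
open Summit.QuantumAdvantage.QuantumAdvantage.Theorems.SosSandwich.CircuitToQuery (exists_queryAlg_acceptPoly)

/-! ### §1 Two degenerate cases: constant cube values have variance `0` -/

/-- A polynomial with constant cube values has variance `0`. [folklore] -/
theorem boolVariance_eq_zero_of_forall_eq {N : ℕ} {p : MvPolynomial (Fin N) ℝ} (h : ∀ x y, evalBool p x = evalBool p y) :
    boolVariance p = 0 := by
  have hconst : evalBool p = fun _ => evalBool p (fun _ => false) := funext fun y => h y _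
  unfold boolVariance
  rw [hconst, boolAvg_const]
  simp

/-- Over `0` variables every polynomial has variance `0` (the cube is a point). [folklore] -/
theorem boolVariance_eq_zero_of_eq_zero {N : ℕ} (hN : N = 0) (p : MvPolynomial (Fin N) ℝ) : boolVariance p = 0 :=
  boolVariance_eq_zero_of_forall_eq fun a b => by
    rw [show a = b from funext fun i => absurd i.2 (by omega)]

/-! ### §2 Restrictions of query acceptance polynomials are query acceptance polynomials -/

/-- **`Q_T` is closed under restriction along a path** (iterate `restrictAlg_acceptProb`): if `p` has the cube values of a
`T`-query algorithm, so does `p|_ρ`, with the same `T`. [cite: BuhrmanDewolf2002, §3] -/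
theorem exists_alg_restrictPath {N : ℕ} (ρ : List (Fin N × Bool)) :
    ∀ (Q : QQueryAlg N) (p : MvPolynomial (Fin N) ℝ), (∀ x, evalBool p x = Q.acceptProb x) →
      ∃ Q' : QQueryAlg N, Q'.queries = Q.queries ∧ ∀ x, evalBool (restrictPath ρ p) x = Q'.acceptProb x := by
  induction ρ with
  | nil => intro Q p hp; exact ⟨Q, rfl, hp⟩
  | cons e ρ ih =>
    intro Q p hp
    obtain ⟨Q', hQ', h'⟩ := ih (restrictAlg Q e.1 e.2) (restrictPoly e.1 e.2 p) fun x => by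
      rw [evalBool_restrictPoly, hp, restrictAlg_acceptProb]
    exact ⟨Q', hQ', fun x => by rw [restrictPath_cons]; exact h' x⟩

/-! ### §3 `AA_Q ⟹ AApath` -/

/-- **The Aaronson–Ambainis conjecture for quantum query algorithms implies the path-wise influence bound for oracle
circuits** over any unitary gate set, with the same constants: `p_x|_ρ` is the acceptance polynomial of a query algorithm
with `q = #oracle gates` queries (`exists_queryAlg_acceptPoly` + `exists_alg_restrictPath`), and `(ε/(2q+1))^c ≤ (ε/q)^c`;
the cases `numOracleBits = 0` and `q = 0` have variance `0`. [cite: AaronsonAmbainis2014, Thm. 23 (proof, p. 14)] -/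
theorem pathBound_of_aaQuery {G : QGateSet} (hG : G.IsUnitary)
    (hAAQ : ∃ (c : ℕ) (C : ℝ), 0 < C ∧ ∀ (N : ℕ) (Q : QQueryAlg N) (p : MvPolynomial (Fin N) ℝ) (ε : ℝ),
      1 ≤ Q.queries → (∀ x, evalBool p x = Q.acceptProb x) → 0 < ε → ε ≤ boolVariance p →
        ∃ i : Fin N, C * (ε / Q.queries) ^ c ≤ influence i p) :
    ∃ (c : ℕ) (C₀ : ℝ), 0 < C₀ ∧ ∀ (F : QCircuitFamily G) (x : List Bool)
      (ρ : List (Fin (numOracleBits F x) × Bool)) (ε : ℝ), 0 < ε →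
      ε ≤ boolVariance (restrictPath ρ (acceptPoly F x)) →
        ∃ i : Fin (numOracleBits F x),
          C₀ * (ε / thm23Degree F x) ^ c ≤ influence i (restrictPath ρ (acceptPoly F x)) := by
  obtain ⟨c, C, hC, H⟩ := hAAQ
  refine ⟨c, C, hC, fun F x ρ ε hε hv => ?_⟩
  rcases Nat.eq_zero_or_pos (numOracleBits F x) with hN0 | hN
  · exfalso
    rw [boolVariance_eq_zero_of_eq_zero hN0] at hv
    exact absurd hv (not_le.2 hε)
  obtain ⟨Q, hQq, hQp⟩ := exists_queryAlg_acceptPoly F x hG hN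
  obtain ⟨Q', hQ'q, hQ'p⟩ := exists_alg_restrictPath ρ Q (acceptPoly F x) hQp
  rcases Nat.eq_zero_or_pos (F.circ x.length).oracleQueries with hq0 | hq
  · exfalso
    have hv0 : boolVariance (restrictPath ρ (acceptPoly F x)) = 0 :=
      boolVariance_eq_zero_of_forall_eq fun a b => by
        rw [hQ'p, hQ'p]
        exact PBAAQuerySimulable.acceptProb_const_of_queries_eq_zero Q' (by rw [hQ'q, hQq, hq0]) a b
    rw [hv0] at hv
    exact absurd hv (not_le.2 hε)
  obtain ⟨i, hi⟩ := H _ Q' (restrictPath ρ (acceptPoly F x)) ε (by rw [hQ'q, hQq]; exact hq) hQ'p hε hv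
  refine ⟨i, le_trans ?_ hi⟩
  rw [hQ'q, hQq]
  have hqpos : (0 : ℝ) < (F.circ x.length).oracleQueries := by exact_mod_cast hq
  unfold thm23Degree
  gcongr
  · linarith

/-! ### §4 The summit assembly from `AA_Q` -/

/-- **`TransferPB` with the analytic crux `AA_Q`**: if the Aaronson–Ambainis influence bound holds for the acceptance
probabilities of quantum QUERY algorithms and `PromiseBQP ⊆ PromiseBPP'`, then `BQP^A ⊆ AvgP^A` for almost every random oracle
`A` (`transfer_of_pathBound ∘ pathBound_of_aaQuery`, Clifford+T is unitary). [cite: AaronsonAmbainis2014, Thm. 7 (iii), Thm. 23] -/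
theorem transfer_of_aaQuery
    (hAAQ : ∃ (c : ℕ) (C : ℝ), 0 < C ∧ ∀ (N : ℕ) (Q : QQueryAlg N) (p : MvPolynomial (Fin N) ℝ) (ε : ℝ),
      1 ≤ Q.queries → (∀ x, evalBool p x = Q.acceptProb x) → 0 < ε → ε ≤ boolVariance p →
        ∃ i : Fin N, C * (ε / Q.queries) ^ c ≤ influence i p)
    (hPr : Literature.Computability.Cryptography.PromiseBQP ⊆ Literature.Computability.Complexity.PromiseBPP') :
    ∀ᵐ A ∂randomOracle,
      BQPRel (A : Language Bool) ⊆
        Literature.Computability.Complexity.AvgPRel (Oracle.ofLanguage (A : Language Bool)) :=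
  SimTreePB.transfer_of_pathBound (pathBound_of_aaQuery cliffordT_isUnitary_holds hAAQ) hPr

/-- **The summit assembly with the analytic crux `AA_Q`**: `AA_Q → RandomOracleHeurSeparation → PromiseLanguageLift →
QuantumAdvantage`.  The route's `closes` with `PseudoBoundedAA` (SOS class `K_T`) replaced by the Aaronson–Ambainis conjecture
for quantum query acceptance probabilities (class `Q_T ⊆ K_T`). [cite: AaronsonAmbainis2014, Thm. 7 (iii)] -/
theorem quantumAdvantage_of_aaQuery
    (hAAQ : ∃ (c : ℕ) (C : ℝ), 0 < C ∧ ∀ (N : ℕ) (Q : QQueryAlg N) (p : MvPolynomial (Fin N) ℝ) (ε : ℝ),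
      1 ≤ Q.queries → (∀ x, evalBool p x = Q.acceptProb x) → 0 < ε → ε ≤ boolVariance p →
        ∃ i : Fin N, C * (ε / Q.queries) ^ c ≤ influence i p)
    (hX : RandomOracleHeurSeparation) (hPL : PromiseLanguageLift) : _root_.QuantumAdvantage :=
  SimTreePB.quantumAdvantage_of_pathBound (pathBound_of_aaQuery cliffordT_isUnitary_holds hAAQ) hX hPL

/-- **… from LEVEL DESCENT inside `Q_T`** (the `Q_T` line of the crux, `QueryTopLevel.aaQuery_of_levelDescentQ`: a
variance-retaining, influence-dominated one-query-or-top-homogeneous QUERY surrogate with polynomial loss; both base rungs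
are proved in the tree). [cite: EscuderoGutierrez2023, Question 4.5] -/
theorem quantumAdvantage_of_levelDescentQ
    (hLD : ∃ (a : ℕ) (A B : ℝ), 0 < A ∧ 0 < B ∧
      ∀ (N : ℕ) (Q : QQueryAlg N) (p : MvPolynomial (Fin N) ℝ) (ε : ℝ),
        1 ≤ Q.queries → (∀ x, evalBool p x = Q.acceptProb x) → 0 < ε → ε ≤ boolVariance p →
        ∃ (N' : ℕ) (Q' : QQueryAlg N') (q : MvPolynomial (Fin N') ℝ),
          1 ≤ Q'.queries ∧ Q'.queries ≤ Q.queries ∧ (∀ x, evalBool q x = Q'.acceptProb x) ∧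
          (Q'.queries = 1 ∨ ∀ x : Fin N' → Bool,
            ∑ i : Fin N', (evalBool q x - evalBool q (Function.update x i (!x i))) =
              4 * (Q'.queries : ℝ) * (evalBool q x - boolAvg (evalBool q))) ∧
          A * (ε / Q.queries) ^ a ≤ boolVariance q ∧
          ∀ i : Fin N', ∃ i' : Fin N, influence i q ≤ B * influence i' p)
    (hX : RandomOracleHeurSeparation) (hPL : PromiseLanguageLift) : _root_.QuantumAdvantage :=
  quantumAdvantage_of_aaQuery (QueryTopLevel.aaQuery_of_levelDescentQ hLD) hX hPL

end Summit.QuantumAdvantage.QuantumAdvantage.Theorems.SosSandwich.QueryCrux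
end
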